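import Summits.NavierStokesRegularity.NavierStokesRegularity.Theorems.ScenarioCensusRowF1RingTop
import HarnessLib

/-!
# LINE 44 «ring-top» port, part 2/6: §2 COMPACTNESS of `𝒦_M` with values AND GRADIENTS locally uniform on slices (the line's own strengthened `limitClass_compact` / socket) and §3 Leray's
# every-time floor (BY NAME) with the witness zoom package carrying gradients

Re-homed for the scenario census (typer seat ns-census-typer-1 g10; the cells F1rx / F1krx and the floors are members of row F1 «DECIDED IN KERNEL IN FILES» (LINE 44: ref ns-census-ref g16
PRE-CHECK ✓ §21.18, critic PASS, lead booking OF RECORD at census v1.133); this port makes them TREE-decided): VERBATIM PORT of ns-idea-3 LINE 44 «ring-top»,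
`pub/ideators/ns-idea-3/lines/ring-top/line-ring-top.lean` sha16 74d818dbb34ba3da (1774 l., lean check rc 0, 0 sorry), split for the 400-line rule into `ScenarioCensusRowF1RingTop`
(§1) → `…RingTopZoom` (§2–§3) → `…RingTopCovariance` (§4a) → `…RingTopKill` (§4b) → `…RingTopFloors` (§5) → `…RingTopRows` (§6–§7 + census KEYS).  Lean text VERBATIM in namespace
`…Theorems.ScenarioCensus.RingTop` (the line's `…Cruxes.ScenarioCensusRowF1.RingTopLine` re-homed); port edits: the frame restated VERBATIM by the line from LINES 34–42 (`topSet`,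
`HasTypeIConstant`, `snapLevel`, `exists_fast_at`, `sqrt_mul_sq_mul`, `continuous_slice'`, `rotLin`, `rotCLM`, `coe_rotCLM`, `analyticAt_transport`, `rotZ_smul_eZ'`, `zoom_units`,
`eventually_forall_not_of_not_frequently`, `le_of_units`) is taken BY NAME from the landed ports (the line's own STRENGTHENED compactness / socket / zoom package / `tendsto_eval` with gradients are new statements and kept; `row_of_floor` = `ScalingTop.row_of_floor` BY NAME); elementary lemmas the line restates are the tree's BY NAME (`rotZ_add_vec'` / `rotZ_add_smul_eZ'` = `ScrewBlowdown.…`,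
`rotZ_smul_vec'` = `rotZ_smul`, `rotZ_neg_rotZ'` / `rotZ_rotZ_neg'` = `RotationOrder.…`, `rotZ_zero_vec'` = `rotZ_apply_zero_vec`, `curl_const_smul'` = `curl_const_smul_field`, `continuous_rotZ`,
`centre_mem` = `IsTypeIAncientMild.comp_add_right`, `hasDerivAt_rotZ_rotGen'` = `AxisymEndLiouville.AbsorbingAxisSwirlExtinction.hasDerivAt_rotZ_rotGen`, `rotGen_add_smul_eZ'` =
`PeriodicSlab.rotGen_add_smul_eZ`, `inner_gradient_eq_fderiv` = `Wu2026Salvage.inner_gradient_right_eq`, `rotZ_single_two` = `UnthreadedRigidity.ProfileHorn.rotZ_single_two'` — cone-free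
modules imported); `tendstoLocallyUniformly_comp_of_tendsto`, `analyticAt_linIso`, `smul_coord` (twins of lemmas in route-cone modules) are not re-declared (inlined / replaced by
`PiLp.smul_apply, smul_eq_mul`); `@[conjecture]` on the residual `RingCollapse` (≡ `ScenarioCensus.Row_F1`, OPEN); one-line docstrings added where missing (gate lint).  Statements untouched.

No census VALUE is moved here (row F1 stays OPEN-WITH-LINE; the members become TREE-decided by name); NS regularity is NOT proved; `Row_F1` is untouched (zero
movement, `ringCollapse_iff_rowF1`); no summit statement is proved by this file. Lemmas that restate already-landed tree declarations are taken BY NAME (gate lint `dedup.landed`): `topSet` = `TwoTimeTop.topSet`, `HasTypeIConstant` = `OneLevelTop.HasTypeIConstant`, `snapLevel` = `SnapshotTop.snapLevel`, `exists_fast_at` = `SnapshotTop.exists_fast_at`, `sqrt_mul_sq_mul` = `SnapshotTop.sqrt_mul_sq_mul`, `centre_mem` = `IsTypeIAncientMild.comp_add_right`, `continuous_slice'` = `ScalingTop.continuous_slice'`, `rotZ_add_vec'` = `ScrewBlowdown.rotZ_add_vec`, `rotZ_smul_vec'` = `rotZ_smul`, `rotZ_add_smul_eZ'` = `ScrewBlowdown.rotZ_add_smul_eZ`,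 `rotLin` = `ScrewTop.rotLin`, `rotCLM` = `ScrewTop.rotCLM`, `analyticAt_transport` = `ScrewTop.analyticAt_transport`, `rotZ_smul_eZ'` = `ScrewTop.rotZ_smul_eZ'`, `hasDerivAt_rotZ_rotGen'` = `AxisymEndLiouville.AbsorbingAxisSwirlExtinction.hasDerivAt_rotZ_rotGen`, `rotGen_add_smul_eZ'` = `PeriodicSlab.rotGen_add_smul_eZ`, `inner_gradient_eq_fderiv` = `Wu2026Salvage.inner_gradient_right_eq`, `rotZ_single_two` = `UnthreadedRigidity.ProfileHorn.rotZ_single_two'`, `rotZ_neg_rotZ'` = `RotationOrder.rotZ_neg_rotZ`, `rotZ_rotZ_neg'` = `RotationOrder.rotZ_rotZ_neg`, `rotZ_zero_vec'` = `rotZ_apply_zero_vec`, `curl_const_smul'` = `curl_const_smul_field`, `zoom_units` = `NeedleTop.zoom_units`, `eventually_forall_not_of_not_frequently` = `EchoTop.eventually_forall_not_of_not_frequently`, `le_of_units` = `ScalingTop.le_of_units`, `row_of_floor` = `ScalingTop.row_of_floor`.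
-/

-- the summit and its single problem share the name `NavierStokesRegularity` (D-0017 nested layout)
set_option linter.dupNamespace false

noncomputable section

open MeasureTheory Set Function Filter TopologicalSpace Metric
open scoped Topology NNReal ENNReal InnerProductSpace RealInnerProductSpace

namespace Summit.NavierStokesRegularity.NavierStokesRegularity.Theorems.ScenarioCensus.RingTop

open Literature.Analysis Literature.Analysis.FluidPDE
open Summit.NavierStokesRegularity.NavierStokesRegularity.Theorems
open Summit.NavierStokesRegularity.NavierStokesRegularity.Theses
open Summit.NavierStokesRegularity.NavierStokesRegularity.Theorems.LocalHelicityTubeDoorFrobeniusProfileRigidityHelicalSlice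
open Summit.NavierStokesRegularity.NavierStokesRegularity.Theorems.NearExtremalTransiencePerFlow.FilamentSelection
open Summit.NavierStokesRegularity.NavierStokesRegularity.Theorems.LocalSineTubeDoorProfileAlignedWindowRigidityAncient

/-! ## §2 COMPACTNESS of `𝒦_M` (values AND GRADIENTS, pointwise and LOCALLY UNIFORMLY on slices) and the SOCKET LEMMA

`𝒦_M` = `IsTypeIAncientMild M`.  The tree's extraction theorem `exists_tendsto_of_typeI_seq_Ioo` (KNSS 2009, Lemma 6.1) fed with
MEMBERS of `𝒦_M` is the sequential compactness of `𝒦_M` (values pointwise and locally uniformly on slices, gradients pointwise;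
LINES 36–43, plus the locally uniform GRADIENT clause).  A POCKET read-out is evaluated at points `b_j + L w` that MOVE with the apex `b_j` of the zoom, so this line
uses the LOCALLY UNIFORM clause (as LINES 38–42 did): after a further compactness step on the apex, a locally uniformly
convergent sequence of slices is evaluated along convergent sequences of points (`TendstoLocallyUniformly.tendsto_comp`). -/

/-- **Compactness of `𝒦_M`** (values and gradients on every slice of the open past: pointwise AND locally uniformly — the LOCALLY
UNIFORM GRADIENT clause of the tree's extraction theorem, discarded by LINES 36–43, is what a FIRST-ORDER read-out with a moving apex
needs). -/
theorem limitClass_compact (M : ℝ) (Wn : ℕ → ℝ → E3 → E3) (h : ∀ n, IsTypeIAncientMild M (Wn n)) :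
    ∃ φ : ℕ → ℕ, StrictMono φ ∧ ∃ W : ℝ → E3 → E3, IsTypeIAncientMild M W ∧
      (∀ t < 0, ∀ y : E3, Tendsto (fun j => Wn (φ j) t y) atTop (𝓝 (W t y))) ∧
      (∀ t < 0, ∀ y : E3, Tendsto (fun j => fderiv ℝ (Wn (φ j) t) y) atTop (𝓝 (fderiv ℝ (W t) y))) ∧
      (∀ t < 0, TendstoLocallyUniformly (fun j => Wn (φ j) t) (W t) atTop) ∧
      (∀ t < 0, TendstoLocallyUniformly (fun j => fderiv ℝ (Wn (φ j) t)) (fderiv ℝ (W t)) atTop) := by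
  set A : ℕ → ℝ := fun n => -((n : ℝ) + 1) with hA
  have hAlim : Tendsto A atTop atBot := by
    have h1 : Tendsto (fun n : ℕ => (n : ℝ) + 1) atTop atTop :=
      tendsto_atTop_add_const_right _ _ tendsto_natCast_atTop_atTop
    exact tendsto_neg_atTop_atBot.comp h1
  have hsub : ∀ n, Ioo (A n) 0 ×ˢ (univ : Set E3) ⊆ Iio 0 ×ˢ univ := fun n =>
    prod_mono (fun t ht => ht.2) subset_rfl
  have hc : ∀ n, ContinuousOn (uncurry (Wn n)) (Ioo (A n) 0 ×ˢ univ) := fun n =>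
    (h n).continuousOn_uncurry.mono (hsub n)
  have hdiv : ∀ n, ∀ t ∈ Ioo (A n) 0, IsWeaklyDivFree (Wn n t) := fun n t ht =>
    (h n).isWeaklyDivFree ht.2
  have hmild : ∀ n, ∀ s t : ℝ, A n < s → s < t → t < 0 → ∀ x,
      Wn n t x = UnboundedOperators.heatExtension (Wn n s) (t - s) x -
        oseenDuhamel 1 s (Wn n) (Wn n) t x :=
    fun n s t _ hst ht x => (h n).mild_eq_heatExtension hst ht x
  have hI : ∀ n, ∀ t ∈ Ioo (A n) 0, ∀ x, ‖Wn n t x‖ ≤ M / Real.sqrt (-t) := fun n t ht x =>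
    (h n).norm_le ht.2 x
  obtain ⟨φ, hφ, W, hW, hpt, hgrad, hlu, hlug⟩ := exists_tendsto_of_typeI_seq_Ioo M hAlim hc hdiv hmild hI
  exact ⟨φ, hφ, W, hW, hpt, hgrad, hlu, hlug⟩

-- `tendstoLocallyUniformly_comp_of_tendsto`: a statement-twin of the landed `AdaptedFrequencyTangentFlowTransfer.tendstoLocallyUniformly_comp_of_tendsto` (route-cone module, NOT imported); not re-declared — its 3-line proof is inlined in `tendsto_eval`.

/-- **SOCKET LEMMA (the compactness upgrade; LINES 35–43 verbatim plus the gradient clause).**  Let `P Λ W` be any «defect of `W` below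
`Λ`» predicate.  Suppose the LIMIT KILL: whenever members `W_n ∈ 𝒦_M` with `P εₙ W_n`, `εₙ → 0⁺`, converge (values pointwise and
locally uniformly on slices, gradients pointwise, on the open past) to `W ∈ 𝒦_M`, the limit rests at `(−1, 0)`.  Then there is ONE
LEVEL `Λ₁ = Λ₁(M, κ, P) > 0` such that no `W ∈ 𝒦_M` with `‖W(−1, 0)‖ ≥ κ` has defect below `Λ₁`.  (Contradiction + compactness;
`Λ₁` is ineffective.) -/
theorem exists_level_of_limitKill (M : ℝ) {κ : ℝ} (hκ : 0 < κ) (P : ℝ → (ℝ → E3 → E3) → Prop)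
    (hkill : ∀ (Wn : ℕ → ℝ → E3 → E3) (W : ℝ → E3 → E3) (ε : ℕ → ℝ),
      (∀ n, 0 < ε n) → Tendsto ε atTop (𝓝 0) → (∀ n, IsTypeIAncientMild M (Wn n)) → IsTypeIAncientMild M W →
      (∀ n, P (ε n) (Wn n)) → (∀ t < 0, ∀ y : E3, Tendsto (fun n => Wn n t y) atTop (𝓝 (W t y))) →
      (∀ t < 0, ∀ y : E3, Tendsto (fun n => fderiv ℝ (Wn n t) y) atTop (𝓝 (fderiv ℝ (W t) y))) →
      (∀ t < 0, TendstoLocallyUniformly (fun n => Wn n t) (W t) atTop) →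
      (∀ t < 0, TendstoLocallyUniformly (fun n => fderiv ℝ (Wn n t)) (fderiv ℝ (W t)) atTop) →
      W (-1) 0 = 0) :
    ∃ Λ₁ : ℝ, 0 < Λ₁ ∧ ∀ W : ℝ → E3 → E3, IsTypeIAncientMild M W → κ ≤ ‖W (-1) 0‖ → ¬ P Λ₁ W := by
  by_contra hno
  have hex : ∀ n : ℕ, ∃ W : ℝ → E3 → E3,
      IsTypeIAncientMild M W ∧ κ ≤ ‖W (-1) 0‖ ∧ P (1 / ((n : ℝ) + 1)) W := by
    intro n
    by_contra hn
    exact hno ⟨1 / ((n : ℝ) + 1), by positivity, fun W hW hκW hP => hn ⟨W, hW, hκW, hP⟩⟩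
  choose Wn hWn hκn hPn using hex
  obtain ⟨φ, hφ, W, hW, hpt, hgrad, hlu, hlug⟩ := limitClass_compact M Wn hWn
  have hφt : Tendsto φ atTop atTop := hφ.tendsto_atTop
  set ε : ℕ → ℝ := fun j => 1 / ((φ j : ℝ) + 1) with hε
  have hεpos : ∀ j, 0 < ε j := fun j => by simp only [hε]; positivity
  have hεlim : Tendsto ε atTop (𝓝 0) := by
    have h1 : Tendsto (fun j => (φ j : ℝ) + 1) atTop atTop :=
      tendsto_atTop_add_const_right _ _ (tendsto_natCast_atTop_atTop.comp hφt)
    exact tendsto_const_nhds.div_atTop h1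
  have hzero : W (-1) 0 = 0 :=
    hkill (fun j => Wn (φ j)) W ε hεpos hεlim (fun j => hWn (φ j)) hW (fun j => hPn (φ j))
      (fun t ht y => hpt t ht y) (fun t ht y => hgrad t ht y) (fun t ht => hlu t ht) (fun t ht => hlug t ht)
  have hge : κ ≤ ‖W (-1) 0‖ :=
    ge_of_tendsto ((hpt (-1) (by norm_num) 0).norm) (Eventually.of_forall fun j => hκn (φ j))
  rw [hzero, norm_zero] at hge
  exact absurd hge (not_le.2 hκ)

/-! ## §3 Leray's EVERY-TIME floor (for the census rows) and the WITNESS ZOOM PACKAGE (LINE 39 verbatim plus the gradient clause: zooms centred at GIVEN fast points)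

LINES 36–38 centred their zooms at `c_S`-fast points supplied by Leray's every-time lower rate under NON-extension (`SnapshotTop.exists_fast_at`,
kept here for the census-shaped rows).  THE WITNESS PACKAGE below instead takes the centres FROM THE HYPOTHESIS: if frequently as
`t ↑ T` there is a `Λ`-fast point `x` with a property `Q t x`, the zooms centred at such `(t_j, x_j)` converge in `𝒦_M` (SAME `M`) to a
limit with `‖W(−1, 0)‖ ≥ Λ` — for ANY level `Λ`, with NO maximality hypothesis (the Type-I window alone runs the tree's zoom lemmas
`zoom_continuousOn` / `zoom_isWeaklyDivFree` / `zoom_oseen` / `zoom_norm_le` and the extraction `exists_tendsto_of_typeI_seq_Ioo`).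
This is what makes the floors UNIVERSAL over fast points (every `Λ`-fast point fails the scaling read-out), where LINES 36–38 could
only say that SOME `c_S`-fast point fails to be calm. -/

-- `exists_fast_at`: the line restates the tree's `SnapshotTop.exists_fast_at`; taken BY NAME (gate lint dedup.landed).

-- `sqrt_mul_sq_mul`: the line restates the tree's `SnapshotTop.sqrt_mul_sq_mul`; taken BY NAME (gate lint dedup.landed).

/-- **THE WITNESS ZOOM PACKAGE (centres given by the hypothesis; any level; no maximality).**  Let `u` be a classical Clay solution
on `[0, T)` with dimensionless Type-I constant `M`, and let `Q t x` be any property such that FREQUENTLY as `t ↑ T` some `Λ`-fast point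
`x` has `Q t x`.  Then there are scales `c_j ↓ 0`, centres `x_j` and a member `W ∈ 𝒦_M` (SAME `M`) such that: at the centre times
`t_j = T − c_j²ν` the centre `x_j` is `Λ`-fast and `Q t_j x_j`; the zooms `c_j u(T + c_j²ν s, x_j + c_jν y)` converge to `W(s, y)` at
every point of the open past (with their spatial gradients, and locally uniformly in `y` on every slice); and `‖W(−1, 0)‖ ≥ Λ`. -/
theorem exists_witnessZoom_package {ν T M : ℝ} (hν : 0 < ν) (hT : 0 < T)
    {u : ℝ → E3 → E3} {p : ℝ → E3 → ℝ}
    (hsol : IsClassicalNSSolutionOn (Ico 0 T) ν 0 u p) (hLH : IsLerayHopfOn T ν 0 (u 0) u)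
    (hdec : HasRapidSpatialDecay (u 0)) (hM : OneLevelTop.HasTypeIConstant ν T M u)
    {Λ : ℝ} {Q : ℝ → E3 → Prop} (hQ : ∃ᶠ t in 𝓝[<] T, ∃ x ∈ TwoTimeTop.topSet ν T u Λ t, Q t x) :
    ∃ (c : ℕ → ℝ) (x : ℕ → E3) (W : ℝ → E3 → E3),
      (∀ j, 0 < c j) ∧ Tendsto c atTop (𝓝 0) ∧ IsTypeIAncientMild M W ∧
      (∀ j, Q (T + c j ^ 2 * ν * (-1)) (x j)) ∧
      (∀ j, x j ∈ TwoTimeTop.topSet ν T u Λ (T + c j ^ 2 * ν * (-1))) ∧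
      (∀ s < 0, ∀ y : E3,
        Tendsto (fun j => (c j * 1) • u (T + c j ^ 2 * ν * s) (x j + (c j * ν) • y)) atTop (𝓝 (W s y))) ∧
      (∀ s < 0, ∀ y : E3,
        Tendsto (fun j => fderiv ℝ (fun y' : E3 => (c j * 1) • u (T + c j ^ 2 * ν * s) (x j + (c j * ν) • y')) y)
          atTop (𝓝 (fderiv ℝ (W s) y))) ∧
      (∀ s < 0, TendstoLocallyUniformly
        (fun j => fun y : E3 => (c j * 1) • u (T + c j ^ 2 * ν * s) (x j + (c j * ν) • y)) (W s) atTop) ∧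
      (∀ s < 0, TendstoLocallyUniformly
        (fun j => fderiv ℝ (fun y : E3 => (c j * 1) • u (T + c j ^ 2 * ν * s) (x j + (c j * ν) • y))) (fderiv ℝ (W s)) atTop) ∧
      Λ ≤ ‖W (-1) 0‖ := by
  -- ## (1) the rate window and the WITNESS sequence `(t_k, x_k)`: `Q t_k x_k`, `T − t_k < δ/(k+2)`, `x_k` `Λ`-fast at `t_k`
  obtain ⟨δ, hδ, hδT, hrate⟩ := OneLevelTop.exists_window_of_hasTypeIConstant hT hM
  have hseq : ∀ k : ℕ, ∃ t : ℝ, ∃ x : E3, t ∈ Ioo (T - δ / ((k : ℝ) + 2)) T ∧ Q t x ∧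
      Λ * Real.sqrt ν ≤ Real.sqrt (T - t) * ‖u t x‖ := by
    intro k
    have hpos : 0 < δ / ((k : ℝ) + 2) := by positivity
    have hIoo : ∀ᶠ t in 𝓝[<] T, t ∈ Ioo (T - δ / ((k : ℝ) + 2)) T := Ioo_mem_nhdsLT (by linarith)
    obtain ⟨t, ⟨x, hxtop, hQtx⟩, htI⟩ := (hQ.and_eventually hIoo).exists
    exact ⟨t, x, htI, hQtx, hxtop⟩
  choose t x htI hQt hfast using hseq
  have hTt : ∀ k, 0 < T - t k := fun k => sub_pos.2 (htI k).2
  have hTtδ : ∀ k, T - t k < δ / ((k : ℝ) + 2) := fun k => by linarith [(htI k).1]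
  -- ## (2) scales `c_k = √((T − t_k)/ν)`: `c_k² ν = T − t_k`, `c_k → 0`
  set c : ℕ → ℝ := fun k => Real.sqrt ((T - t k) / ν) with hc
  have hcpos : ∀ k, 0 < c k := fun k => Real.sqrt_pos.2 (div_pos (hTt k) hν)
  have hc2 : ∀ k, c k ^ 2 * ν = T - t k := by
    intro k
    simp only [hc]
    rw [Real.sq_sqrt (div_pos (hTt k) hν).le]
    field_simp
  have het : ∀ k, T + c k ^ 2 * ν * (-1) = t k := fun k => by rw [hc2 k]; ring
  have hclim : Tendsto c atTop (𝓝 0) := by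
    have hk2 : Tendsto (fun k : ℕ => (k : ℝ) + 2) atTop atTop :=
      tendsto_atTop_add_const_right _ _ tendsto_natCast_atTop_atTop
    have hup0 : Tendsto (fun k : ℕ => δ / ((k : ℝ) + 2)) atTop (𝓝 0) := tendsto_const_nhds.div_atTop hk2
    have hupper : Tendsto (fun k : ℕ => δ / ((k : ℝ) + 2) / ν) atTop (𝓝 0) := by
      simpa using hup0.div_const ν
    have h1 : Tendsto (fun k => (T - t k) / ν) atTop (𝓝 0) :=
      tendsto_of_tendsto_of_tendsto_of_le_of_le tendsto_const_nhds hupper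
        (fun k => (div_pos (hTt k) hν).le) (fun k => div_le_div_of_nonneg_right (hTtδ k).le hν.le)
    have h2 := h1.sqrt
    rw [Real.sqrt_zero] at h2
    exact h2
  -- ## (3) the zooms and their windows `(A_k, 0)`, `A_k → −∞`
  have hα : (1 : ℝ) = ν / ν := (div_self hν.ne').symm
  have hβ : ν = ν ^ 2 / ν := by rw [sq, mul_div_cancel_right₀ _ hν.ne']
  set w : ℕ → ℝ → E3 → E3 := fun k => (c k * 1) • stPull (c k ^ 2 * ν) (c k * ν) T (x k) u with hw
  set Aw : ℕ → ℝ := fun k => -(δ / (c k ^ 2 * ν)) with hA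
  have hAwle : ∀ k, Aw k ≤ -((k : ℝ) + 2) := by
    intro k
    have hk : 0 < (k : ℝ) + 2 := by positivity
    have hprod : (T - t k) * ((k : ℝ) + 2) < δ := (lt_div_iff₀ hk).1 (hTtδ k)
    simp only [hA]
    rw [hc2 k, neg_le_neg_iff, le_div_iff₀ (hTt k)]
    linarith [mul_comm (T - t k) ((k : ℝ) + 2)]
  have hAlim : Tendsto Aw atTop atBot := by
    have h1 : Tendsto (fun k : ℕ => -((k : ℝ) + 2)) atTop atBot :=
      tendsto_neg_atTop_atBot.comp (tendsto_atTop_add_const_right _ _ tendsto_natCast_atTop_atTop)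
    exact tendsto_atBot_mono hAwle h1
  have hcW : ∀ k, ContinuousOn (uncurry (w k)) (Ioo (Aw k) 0 ×ˢ univ) := fun k =>
    zoom_continuousOn hν hsol hν hα hβ (hcpos k) hδT
  have hdivW : ∀ k, ∀ s ∈ Ioo (Aw k) 0, IsWeaklyDivFree (w k s) := fun k s hs =>
    zoom_isWeaklyDivFree hν hsol hν hα hβ (hcpos k) hδT hs
  have hmildW : ∀ k, ∀ s s' : ℝ, Aw k < s → s < s' → s' < 0 → ∀ y,
      w k s' y = UnboundedOperators.heatExtension (w k s) (s' - s) y -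
        oseenDuhamel 1 s (w k) (w k) s' y := fun k s s' hs hss' hs' y =>
    zoom_oseen hν hT hsol hLH hdec hν hα hβ (hcpos k) hδT hs hss' hs' y
  have hIW : ∀ k, ∀ s ∈ Ioo (Aw k) 0, ∀ y, ‖w k s y‖ ≤ M / Real.sqrt (-s) := by
    intro k s hs y
    have h : ‖w k s y‖ ≤ (1 * (M * Real.sqrt ν) / Real.sqrt ν) / Real.sqrt (-s) :=
      zoom_norm_le (x₀ := x k) hν hα hβ hν (hcpos k) hδT hrate hs y
    have e : (1 : ℝ) * (M * Real.sqrt ν) / Real.sqrt ν = M := by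
      rw [one_mul, mul_div_cancel_right₀ _ (Real.sqrt_pos.2 hν).ne']
    rw [e] at h
    exact h
  -- ## (4) extraction of a limit `W ∈ 𝒦_M` (SAME constant `M`), values and gradients pointwise and locally uniformly
  obtain ⟨φ, hφ, W, hW, hpt, hgrad, hlu, hlug⟩ := exists_tendsto_of_typeI_seq_Ioo M hAlim hcW hdivW hmildW hIW
  have hφt : Tendsto φ atTop atTop := hφ.tendsto_atTop
  -- ## (5) normalisation at `(−1, 0)`
  have hnorm : ∀ k, Λ ≤ ‖w k (-1) 0‖ := by
    intro k
    have e1 : w k (-1) 0 = (c k * 1) • u (T + c k ^ 2 * ν * (-1)) (x k + (c k * ν) • (0 : E3)) := by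
      simp only [hw, smul_stPull_apply]
    rw [e1, smul_zero, add_zero, het, mul_one, norm_smul, Real.norm_eq_abs, abs_of_pos (hcpos k)]
    have hsq : Real.sqrt (T - t k) = c k * Real.sqrt ν := by
      rw [← hc2 k, Real.sqrt_mul (sq_nonneg _), Real.sqrt_sq (hcpos k).le]
    have h2 : Λ * Real.sqrt ν ≤ c k * ‖u (t k) (x k)‖ * Real.sqrt ν := by
      have h := hfast k
      rw [hsq] at h
      linarith [h, (by ring : c k * Real.sqrt ν * ‖u (t k) (x k)‖ = c k * ‖u (t k) (x k)‖ * Real.sqrt ν)]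
    exact le_of_mul_le_mul_right h2 (Real.sqrt_pos.2 hν)
  have hge : Λ ≤ ‖W (-1) 0‖ :=
    ge_of_tendsto ((hpt (-1) (by norm_num) 0).norm) (Eventually.of_forall fun j => hnorm (φ j))
  -- ## (6) package along the subsequence
  have hwu : ∀ (k : ℕ) (s : ℝ),
      w k s = fun y => (c k * 1) • u (T + c k ^ 2 * ν * s) (x k + (c k * ν) • y) :=
    fun k s => funext fun y => by simp only [hw, smul_stPull_apply]
  have hfastTop : ∀ k, x k ∈ TwoTimeTop.topSet ν T u Λ (T + c k ^ 2 * ν * (-1)) := by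
    intro k
    rw [TwoTimeTop.mem_topSet, het]
    exact hfast k
  refine ⟨fun j => c (φ j), fun j => x (φ j), W, fun j => hcpos _, hclim.comp hφt, hW,
    fun j => by rw [het]; exact hQt (φ j), fun j => hfastTop (φ j), fun s hs y => ?_, fun s hs y => ?_,
    fun s hs => ?_, fun s hs => ?_, hge⟩
  · exact (hpt s hs y).congr fun j => by rw [hwu]
  · exact (hgrad s hs y).congr fun j => by rw [hwu]
  · intro U hU y
    obtain ⟨V, hV, hev⟩ := hlu s hs U hU y
    refine ⟨V, hV, ?_⟩
    filter_upwards [hev] with j hj z hz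
    simpa only [hwu] using hj z hz
  · intro U hU y
    obtain ⟨V, hV, hev⟩ := hlug s hs U hU y
    refine ⟨V, hV, ?_⟩
    filter_upwards [hev] with j hj z hz
    simpa only [hwu] using hj z hz

end Summit.NavierStokesRegularity.NavierStokesRegularity.Theorems.ScenarioCensus.RingTop

end
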